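import Mathlib
import HarnessLib
import Summits.NavierStokesRegularity.NavierStokesRegularity.Theorems.QuarterLogPincerTruncationEdgeProfileHelpers

/-!
# Crux `QuarterLogPincer.TypeIQuantSubcubicExp` (stmt-24077), line `truncation_edge`: **P3b′ `stub_supShadowingProfile : StubSupShadowingProfile` BY NAME**
Tree copy of the AUTHOR'S PROOF (ns-idea-7 g9, workfile v1.8 «P3b′ PROVED: the pointwise profile by a dyadic-radius bootstrap»:
`supShadowingProfile_of_isTypeIAncientMild`, `stubSupShadowingProfile_holds`), VERBATIM up to whitespace (continuation lines joined to
meet the 400-line file cap), re-homed by the pub-ns-dss typer (g35; `--supports stmt-NavierStokesRegularity-24077`, helper); mechanism: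
near/far source split at dyadic radii `R = r₀2^n` (kernel decay `(R/2)^{-4}` × time-integrable Type-I rate; envelope `A/R` + bootstrap `δ₀`).
Credit: ns-idea-7 g9.  HONEST FRAME: hypothetical objects; closes T1 with the other landed pieces, NOT 24077/22144/NS regularity.
-/

noncomputable section

set_option linter.dupNamespace false
namespace Summit.NavierStokesRegularity.NavierStokesRegularity.Cruxes.TypeIQuantSubcubicExp.TruncationEdge

open MeasureTheory Set Function Metric Filter Topology
open scoped ENNReal NNReal
open Literature.Analysis Literature.Analysis.FluidPDE
open Summit.NavierStokesRegularity.NavierStokesRegularity.Cruxes.TypeIQuantSubcubicExp.ThinCascade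

set_option maxHeartbeats 1600000 in
/-- **P3b′ holds**: the pointwise shadowing profile for Type-I ancient mild references with a
Type-I spatial envelope. [folklore] -/
theorem supShadowingProfile_of_isTypeIAncientMild {M A : ℝ}
    {v : ℝ → EuclideanSpace ℝ (Fin 3) → EuclideanSpace ℝ (Fin 3)}
    (hv : IsTypeIAncientMild M v) (hdec : HasTypeIDecay A v) : SupShadowingProfile v := by
  intro K₀ hK₀
  -- ### constants
  obtain ⟨C, hC, hK⟩ := exists_norm_oseenKernel_le (E := EuclideanSpace ℝ (Fin 3))
  set I : ℝ := ∫ w : EuclideanSpace ℝ (Fin 3), (1 + ‖w‖ ^ 2) ^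
    (-(((Module.finrank ℝ (EuclideanSpace ℝ (Fin 3)) : ℝ) + 1) / 2)) with hI_def
  have hI0 : 0 ≤ I := integral_nonneg fun w => by positivity
  set V₁ : ℝ := volume.real (Metric.ball (0 : EuclideanSpace ℝ (Fin 3)) 1) with hV₁_def
  have hV₁ : 0 ≤ V₁ := measureReal_nonneg
  have hM0 : 0 ≤ M := by
    have h := hv.2.2.2 (-1) (by norm_num) 0
    rw [neg_neg, Real.sqrt_one, div_one] at h
    exact (norm_nonneg _).trans h
  have hA0 : 0 ≤ A := by
    have h := hdec (-1) (by norm_num) 0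
    rw [norm_zero, neg_neg, Real.sqrt_one, zero_add, div_one] at h
    exact (norm_nonneg _).trans h
  set C₁ : ℝ := C * I with hC₁_def
  have hC₁ : 0 ≤ C₁ := mul_nonneg hC.le hI0
  set cnr : ℝ := 32 * C * V₁ * (2 * M + 1) with hcnr_def
  have hcnr : 0 ≤ cnr := by rw [hcnr_def]; exact mul_nonneg (mul_nonneg (mul_nonneg (by norm_num) hC.le) hV₁) (by linarith [hM0])
  set r₀ : ℝ := max 2 (32 * C₁ * A) with hr₀_def
  have hr₀2 : 2 ≤ r₀ := le_max_left _ _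
  have hr₀pos : 0 < r₀ := by linarith
  have hr₀A : 32 * C₁ * A ≤ r₀ := le_max_right _ _
  set δ₀ : ℝ := min 1 (1 / (16 * C₁ + 1)) with hδ₀_def
  have h16 : (0 : ℝ) < 16 * C₁ + 1 := by linarith [hC₁]
  have hδ₀pos : 0 < δ₀ := lt_min one_pos (div_pos one_pos h16)
  have hδ₀1 : δ₀ ≤ 1 := min_le_left _ _
  have hδ₀C : 2 * C₁ * δ₀ ≤ 1 / 8 := by
    have h1 : δ₀ ≤ 1 / (16 * C₁ + 1) := min_le_right _ _
    have h2 : δ₀ * (16 * C₁ + 1) ≤ 1 := by rwa [le_div_iff₀ h16] at h1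
    nlinarith [hδ₀pos.le, hC₁]
  set K : ℝ := 2 * K₀ + 16 * cnr + 4 * r₀ + 1 with hK_def
  have hKnn : 0 ≤ K := by rw [hK_def]; linarith [hK₀, hcnr, hr₀pos]
  refine ⟨δ₀, 1, K, hδ₀pos, hδ₀1, le_rfl, hKnn, ?_⟩
  intro δ' hδ' hδ'δ₀ ρ hρ _hK₀ρ u₀ hdata T' hT' u p hfr hu0 hclose
  have hδ'1 : δ' ≤ 1 := hδ'δ₀.trans hδ₀1
  have hT'0 : 0 < T' := hT'.1
  have hT'1 : T' < 1 := hT'.2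
  have hρ0 : 0 < ρ := by linarith
  have hK₀ρ0 : 0 ≤ K₀ / ρ := div_nonneg hK₀ hρ0.le
  -- ### the fields
  set V : ℝ → EuclideanSpace ℝ (Fin 3) → EuclideanSpace ℝ (Fin 3) := fun τ => v (τ - 1) with hV_def
  set w : ℝ → EuclideanSpace ℝ (Fin 3) → EuclideanSpace ℝ (Fin 3) := fun τ y => u τ y - V τ y
    with hw_def
  have hcl : IsClassicalNSSolutionOn (Icc 0 T') 1 0 u p := hfr.1
  have hvcont : ContinuousOn (uncurry v) (Iio 0 ×ˢ univ) := hv.1.continuousOn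
  have hVcont : ∀ τ ∈ Icc 0 T', Continuous (V τ) := by
    intro τ hτ
    have h : Continuous fun y : EuclideanSpace ℝ (Fin 3) => uncurry v (τ - 1, y) :=
      hvcont.comp_continuous (continuous_const.prodMk continuous_id)
        fun y => ⟨show τ - 1 < 0 by linarith [hτ.2], mem_univ _⟩
    exact h
  have hucont : ∀ τ ∈ Icc 0 T', Continuous (u τ) := fun τ hτ => (hcl.contDiff_velocity hτ).continuous
  have hwcont : ∀ τ ∈ Icc 0 T', Continuous (w τ) := fun τ hτ => (hucont τ hτ).sub (hVcont τ hτ)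
  have hVmeas : AEStronglyMeasurable (uncurry V)
      ((volume : Measure (ℝ × EuclideanSpace ℝ (Fin 3))).restrict (Ioo 0 T' ×ˢ univ)) := by
    have hc : ContinuousOn (uncurry V) (Ioo 0 T' ×ˢ univ) := by
      have hmap : MapsTo (fun q : ℝ × EuclideanSpace ℝ (Fin 3) => (q.1 - 1, q.2))
          (Ioo 0 T' ×ˢ univ) (Iio 0 ×ˢ univ) := by
        intro q hq
        exact ⟨show q.1 - 1 < 0 by have := (mem_prod.1 hq).1; linarith [this.2], mem_univ _⟩
      have hsh : Continuous fun q : ℝ × EuclideanSpace ℝ (Fin 3) => (q.1 - 1, q.2) := (continuous_fst.sub continuous_const).prodMk continuous_snd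
      exact hvcont.comp hsh.continuousOn hmap
    exact hc.aestronglyMeasurable (measurableSet_Ioo.prod MeasurableSet.univ)
  have humeas : AEStronglyMeasurable (uncurry u)
      ((volume : Measure (ℝ × EuclideanSpace ℝ (Fin 3))).restrict (Ioo 0 T' ×ˢ univ)) :=
    (hcl.smooth_velocity.continuousOn.mono (prod_mono Ioo_subset_Icc_self Subset.rfl)).aestronglyMeasurable
      (measurableSet_Ioo.prod MeasurableSet.univ)
  -- ### sup bounds on the slab (constants irrelevant)
  set MV : ℝ := M / Real.sqrt (1 - T') with hMV_def
  have hsT : 0 < Real.sqrt (1 - T') := Real.sqrt_pos.2 (by linarith)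
  have hMV0 : 0 ≤ MV := div_nonneg hM0 hsT.le
  have hrate : ∀ τ ∈ Icc 0 T', ∀ y, ‖V τ y‖ ≤ M / Real.sqrt (1 - τ) := by
    intro τ hτ y
    have h := hv.2.2.2 (τ - 1) (by linarith [hτ.2]) y
    rwa [show -(τ - 1) = 1 - τ by ring] at h
  have hVbd : ∀ τ ∈ Icc 0 T', ∀ y, ‖V τ y‖ ≤ MV := by
    intro τ hτ y
    refine (hrate τ hτ y).trans ?_
    exact div_le_div_of_nonneg_left hM0 hsT (Real.sqrt_le_sqrt (by linarith [hτ.2]))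
  have hwδ : ∀ τ ∈ Icc 0 T', ∀ y, ‖w τ y‖ ≤ δ' := fun τ hτ y => hclose τ hτ y
  have hubd : ∀ τ ∈ Icc 0 T', ∀ y, ‖u τ y‖ ≤ MV + 1 := by
    intro τ hτ y
    have h1 := hwδ τ hτ y
    have h2 := hVbd τ hτ y
    have : ‖u τ y‖ ≤ ‖u τ y - V τ y‖ + ‖V τ y‖ := norm_le_norm_sub_add _ _
    change ‖u τ y - V τ y‖ ≤ δ' at h1
    linarith
  have hubdo : ∀ τ ∈ Ioo 0 T', ∀ y, ‖u τ y‖ ≤ MV + 1 := fun τ hτ => hubd τ ⟨hτ.1.le, hτ.2.le⟩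
  have hVbdo : ∀ τ ∈ Ioo 0 T', ∀ y, ‖V τ y‖ ≤ MV := fun τ hτ => hVbd τ ⟨hτ.1.le, hτ.2.le⟩
  -- the envelope off the core: `‖v(τ-1, z)‖ ≤ A/‖z‖ ≤ A/R` for `‖z‖ ≥ R > 0`
  have henv : ∀ τ ∈ Icc 0 T', ∀ {R : ℝ}, 0 < R → ∀ z : EuclideanSpace ℝ (Fin 3), R ≤ ‖z‖ → ‖V τ z‖ ≤ A / R := by
    intro τ hτ R hR z hz
    have h := hdec (τ - 1) (by linarith [hτ.2]) z
    refine h.trans ?_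
    exact div_le_div_of_nonneg_left hA0 hR (by linarith [Real.sqrt_nonneg (-(τ - 1))])
  -- ### the two mild identities
  have hrepV : ∀ τ ∈ Ioc 0 T', ∀ x, V τ x = UnboundedOperators.heatExtension (V 0) (1 * τ) x - oseenDuhamel 1 0 V V τ x := by
    intro τ hτ x
    have hmild := hv.2.2.1 (-1) (τ - 1) (by linarith [hτ.1]) (by linarith [hτ.2]) x
    have e1 : τ - 1 - (-1) = τ := by ring
    rw [e1, heatFlow, if_pos hτ.1] at hmild
    have htr := oseenDuhamel_translate 1 0 (-1) v v τ x
    rw [zero_add] at htr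
    have hVeq : V = fun σ => v (σ + (-1)) := by funext σ; simp only [hV_def, sub_eq_add_neg]
    rw [hVeq, htr, one_mul]
    simp only
    rw [show (0 : ℝ) + -1 = -1 by norm_num, show τ + -1 = τ - 1 by ring]
    exact hmild
  have hE : ∃ Ce : ℝ≥0∞, Ce < ⊤ ∧ ∀ t ∈ Icc 0 T', ∫⁻ x, ‖u t x‖ₑ ^ 2 ≤ Ce := by
    obtain ⟨Ce, hCe⟩ := hfr.2 0
    refine ⟨(Ce : ℝ≥0∞) ^ 2, by simp, fun t ht => ?_⟩
    have h0 := hCe t ht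
    have hcongr : eLpNorm (iteratedFDeriv ℝ 0 (u t)) 2 volume = eLpNorm (u t) 2 volume := eLpNorm_congr_norm_ae (Eventually.of_forall fun x => by simp)
    rw [hcongr] at h0
    have h := h0
    rw [eLpNorm_eq_lintegral_rpow_enorm_toReal two_ne_zero ENNReal.ofNat_ne_top, ENNReal.toReal_ofNat] at h
    simp only [one_div] at h
    have h' := ENNReal.rpow_le_rpow h (z := 2) (by norm_num)
    rw [← ENNReal.rpow_mul, show (2 : ℝ)⁻¹ * 2 = 1 by norm_num, ENNReal.rpow_one] at h'
    simpa using h'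
  have hgc : Continuous (uncurry (0 : ℝ → EuclideanSpace ℝ (Fin 3) → EuclideanSpace ℝ (Fin 3))) := continuous_const
  have hG : ∀ τ ∈ Icc 0 T', ∀ y, ‖(0 : ℝ → EuclideanSpace ℝ (Fin 3) → EuclideanSpace ℝ (Fin 3)) τ y‖ ≤ 0 := fun τ _ y => by simp
  have hgdiv : ∀ τ ∈ Icc 0 T', IsWeaklyDivFree ((0 : ℝ → EuclideanSpace ℝ (Fin 3) → EuclideanSpace ℝ (Fin 3)) τ) := fun τ _ θ _ => by simp
  have hg2 : ∀ τ ∈ Icc 0 T', eLpNorm ((0 : ℝ → EuclideanSpace ℝ (Fin 3) → EuclideanSpace ℝ (Fin 3)) τ) 2 volume ≤ (0 : ℝ≥0∞) := fun τ _ => by simp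
  have h0 : ∀ t (x : EuclideanSpace ℝ (Fin 3)), forceDuhamel 1 0 (0 : ℝ → EuclideanSpace ℝ (Fin 3) → EuclideanSpace ℝ (Fin 3)) t x = 0 := by
    intro t x
    rw [forceDuhamel_apply]
    have hz : ∀ τ, UnboundedOperators.heatExtension
        ((0 : ℝ → EuclideanSpace ℝ (Fin 3) → EuclideanSpace ℝ (Fin 3)) τ) (1 * (t - τ)) x = 0 := by
      intro τ
      have : ((0 : ℝ → EuclideanSpace ℝ (Fin 3) → EuclideanSpace ℝ (Fin 3)) τ) = fun _ : EuclideanSpace ℝ (Fin 3) => (0 : EuclideanSpace ℝ (Fin 3)) := rfl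
      rw [this, UnboundedOperators.heatExtension_zero_fun]; rfl
    simp_rw [hz, integral_zero]
  have hMV1 : 0 < MV + 1 := by linarith
  have hrepu : ∀ t ∈ Ioc 0 T', ∀ᵐ x ∂(volume : Measure (EuclideanSpace ℝ (Fin 3))), u t x = UnboundedOperators.heatExtension (u 0) (1 * t) x - oseenDuhamel 1 0 u u t x := by
    intro t ht
    have h := hcl.ae_eq_forced_oseenMild one_pos hT'0 hgc hG hgdiv ENNReal.zero_ne_top hg2 hE hMV1
      hubd ht
    filter_upwards [h] with x hx
    rw [hx, h0 t x]
    simp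
  have hBsplit : ∀ t ∈ Ioc 0 T', ∀ y, oseenDuhamel 1 0 u u t y - oseenDuhamel 1 0 V V t y = oseenDuhamel 1 0 w u t y + oseenDuhamel 1 0 V w t y := fun t ht y =>
    oseenDuhamel_self_sub_self one_pos humeas hVmeas hubdo hVbdo ht.1 ht.2 y
  -- the heat term
  have hheat : ∀ t ∈ Ioc 0 T', ∀ y, ‖UnboundedOperators.heatExtension (u 0) (1 * t) y - UnboundedOperators.heatExtension (V 0) (1 * t) y‖ ≤ K₀ / ρ := by
    intro t ht y
    have h0I : (0 : ℝ) ∈ Icc 0 T' := ⟨le_rfl, hT'0.le⟩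
    have h1t : 0 < 1 * t := by linarith [ht.1]
    have hdiff : ∀ z, ‖u 0 z - V 0 z‖ ≤ K₀ / ρ := by
      intro z
      show ‖u 0 z - v (0 - 1) z‖ ≤ K₀ / ρ
      rw [hu0, zero_sub]
      exact hdata z
    rw [← UnboundedOperators.heatExtension_sub_of_bound (hucont 0 h0I) (hVcont 0 h0I) (hubd 0 h0I)
      (hVbd 0 h0I) h1t y]
    exact UnboundedOperators.norm_heatExtension_le hdiff h1t y
  -- ### the dyadic bootstrap
  set α : ℝ := 4 / 3 * (K₀ / ρ) with hα_def
  set β : ℝ := 4 * cnr * δ' / r₀ + δ' with hβ_def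
  have hα0 : 0 ≤ α := by rw [hα_def]; exact mul_nonneg (by norm_num) hK₀ρ0
  have hβ1 : 0 ≤ 4 * cnr * δ' / r₀ := div_nonneg (mul_nonneg (mul_nonneg (by norm_num) hcnr) hδ'.le) hr₀pos.le
  have hβ0 : 0 ≤ β := by rw [hβ_def]; linarith [hδ'.le]
  have hβδ : δ' ≤ β := by rw [hβ_def]; linarith
  set a : ℕ → ℝ := fun n => α + β * (1 / 2) ^ n with ha_def
  have ha0 : ∀ n, 0 ≤ a n := fun n => by show 0 ≤ α + β * (1 / 2) ^ n; exact add_nonneg hα0 (mul_nonneg hβ0 (pow_nonneg (by norm_num) n))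
  have hQ : ∀ n : ℕ, ∀ t ∈ Icc 0 T', ∀ x, r₀ * 2 ^ n ≤ ‖x‖ → ‖w t x‖ ≤ a n := by
    intro n
    induction n with
    | zero =>
      intro t ht x _
      refine (hwδ t ht x).trans ?_
      show δ' ≤ α + β * (1 / 2) ^ 0
      rw [pow_zero, mul_one]; linarith
    | succ n ih =>
      intro t ht x hx
      -- the radius of this step
      obtain ⟨R, hR_def⟩ : ∃ R : ℝ, R = r₀ * 2 ^ n := ⟨_, rfl⟩
      rw [← hR_def] at ih
      have hRr₀ : r₀ ≤ R := by
        have : (1 : ℝ) ≤ 2 ^ n := one_le_pow₀ (by norm_num)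
        rw [hR_def]; nlinarith
      have hR2 : 2 ≤ R := hr₀2.trans hRr₀
      have hRpos : 0 < R := by linarith
      have hx2R : 2 * R ≤ ‖x‖ := by rw [hR_def]; rw [pow_succ] at hx; linarith
      -- the target bound of this step and why it is `≤ a (n+1)`
      have hstep : K₀ / ρ + cnr * δ' / R + 1 / 4 * a n ≤ a (n + 1) := by
        have hq : 0 ≤ (1 / 2 : ℝ) ^ n := by positivity
        have h2n : (0 : ℝ) < 2 ^ n := by positivity
        have hRinv : cnr * δ' / R = cnr * δ' / r₀ * (1 / 2) ^ n := by rw [hR_def, one_div_pow]; field_simp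
        have h1 : cnr * δ' / r₀ + β / 4 ≤ β / 2 := by
          have e : 4 * cnr * δ' / r₀ = 4 * (cnr * δ' / r₀) := by ring
          rw [hβ_def, e]; linarith [hδ'.le]
        have e1 : K₀ / ρ + cnr * δ' / R + 1 / 4 * a n = α + (1 / 2 : ℝ) ^ n * (cnr * δ' / r₀ + β / 4) := by rw [hRinv]; simp only [ha_def, hα_def]; ring
        have e2 : a (n + 1) = α + (1 / 2 : ℝ) ^ n * (β / 2) := by simp only [ha_def, pow_succ]; ring
        rw [e1, e2]
        linarith [mul_le_mul_of_nonneg_left h1 hq]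
      rcases ht.1.eq_or_lt with h0 | ht0
      · -- `t = 0`
        rw [← h0]
        have : ‖w 0 x‖ ≤ K₀ / ρ := by show ‖u 0 x - v (0 - 1) x‖ ≤ K₀ / ρ; rw [hu0, zero_sub]; exact hdata x
        have h2 : 0 ≤ cnr * δ' / R := div_nonneg (mul_nonneg hcnr hδ'.le) hRpos.le
        linarith [ha0 n]
      have htI : t ∈ Ioc 0 T' := ⟨ht0, ht.2⟩
      have ht1 : t < 1 := lt_of_le_of_lt ht.2 hT'1
      -- the time-integrable near bound
      obtain ⟨hPi, hPle⟩ := setIntegral_rate_le hM0 ht0 ht1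
      obtain ⟨P, hP_def⟩ : ∃ P : ℝ → ℝ, P = fun τ => δ' * (M / Real.sqrt (1 - τ) + 1) := ⟨_, rfl⟩
      have hPτ : ∀ τ, P τ = δ' * (M / Real.sqrt (1 - τ) + 1) := fun τ => by rw [hP_def]
      have hPi' : IntegrableOn P (Ioo 0 t) := by rw [hP_def]; exact hPi.const_mul δ'
      have hP0 : ∀ τ ∈ Ioo 0 t, 0 ≤ P τ := by
        intro τ hτ
        have : 0 < Real.sqrt (1 - τ) := Real.sqrt_pos.2 (by linarith [hτ.2])
        rw [hPτ]
        exact mul_nonneg hδ'.le (add_nonneg (div_nonneg hM0 this.le) zero_le_one)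
      have hPint : ∫ τ in Ioo 0 t, P τ ≤ δ' * (2 * M + 1) := by rw [hP_def, integral_const_mul]; exact mul_le_mul_of_nonneg_left hPle hδ'.le
      have hmemτ : ∀ τ ∈ Ioo 0 t, τ ∈ Icc 0 T' := fun τ hτ => ⟨hτ.1.le, hτ.2.le.trans ht.2⟩
      -- near products
      have hnear1 : ∀ τ ∈ Ioo 0 t, ∀ y : EuclideanSpace ℝ (Fin 3), ‖y‖ < R → ‖w τ y‖ * ‖u τ y‖ ≤ P τ := by
        intro τ hτ y _
        have hτ' := hmemτ τ hτ
        have h1 := hwδ τ hτ' y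
        have h2 := hrate τ hτ' y
        have h3 : ‖u τ y‖ ≤ ‖u τ y - V τ y‖ + ‖V τ y‖ := norm_le_norm_sub_add _ _
        change ‖u τ y - V τ y‖ ≤ δ' at h1
        have hs : 0 < Real.sqrt (1 - τ) := Real.sqrt_pos.2 (by linarith [hτ'.2])
        have h4 : ‖u τ y‖ ≤ M / Real.sqrt (1 - τ) + 1 := by linarith
        calc ‖w τ y‖ * ‖u τ y‖ ≤ δ' * (M / Real.sqrt (1 - τ) + 1) := mul_le_mul (hwδ τ hτ' y) h4 (norm_nonneg _) hδ'.le
          _ = P τ := (hPτ τ).symm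
      have hnear2 : ∀ τ ∈ Ioo 0 t, ∀ y : EuclideanSpace ℝ (Fin 3), ‖y‖ < R → ‖V τ y‖ * ‖w τ y‖ ≤ P τ := by
        intro τ hτ y _
        have hτ' := hmemτ τ hτ
        have hs : 0 < Real.sqrt (1 - τ) := Real.sqrt_pos.2 (by linarith [hτ'.2])
        have hMd : 0 ≤ M / Real.sqrt (1 - τ) := div_nonneg hM0 hs.le
        calc ‖V τ y‖ * ‖w τ y‖ ≤ M / Real.sqrt (1 - τ) * δ' := mul_le_mul (hrate τ hτ' y) (hwδ τ hτ' y) (norm_nonneg _) hMd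
          _ ≤ P τ := by rw [hPτ]; nlinarith [hδ'.le]
      -- far sup bounds
      have hfarw : ∀ τ ∈ Ioo 0 t, ∀ y : EuclideanSpace ℝ (Fin 3), R ≤ ‖y‖ → ‖w τ y‖ ≤ a n := fun τ hτ y hy => ih τ (hmemτ τ hτ) y hy
      have hfarV : ∀ τ ∈ Ioo 0 t, ∀ y : EuclideanSpace ℝ (Fin 3), R ≤ ‖y‖ → ‖V τ y‖ ≤ A / R := fun τ hτ y hy => henv τ (hmemτ τ hτ) hRpos y hy
      have hfaru : ∀ τ ∈ Ioo 0 t, ∀ y : EuclideanSpace ℝ (Fin 3), R ≤ ‖y‖ → ‖u τ y‖ ≤ A / R + δ₀ := by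
        intro τ hτ y hy
        have h1 := hwδ τ (hmemτ τ hτ) y
        change ‖u τ y - V τ y‖ ≤ δ' at h1
        have h2 := hfarV τ hτ y hy
        have h3 : ‖u τ y‖ ≤ ‖u τ y - V τ y‖ + ‖V τ y‖ := norm_le_norm_sub_add _ _
        linarith
      have hAR : 0 ≤ A / R := div_nonneg hA0 hRpos.le
      have hARδ : 0 ≤ A / R + δ₀ := by linarith
      have hR1 : 1 ≤ R / 2 := by linarith
      -- the two Duhamel bounds at points `‖y‖ ≥ R + R/2`
      have hB1 : ∀ y : EuclideanSpace ℝ (Fin 3), R + R / 2 ≤ ‖y‖ → ‖oseenDuhamel 1 0 w u t y‖ ≤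
          C * volume.real (Metric.ball (0 : EuclideanSpace ℝ (Fin 3)) R) * (R / 2) ^ (-(4 : ℝ)) * (∫ τ in Ioo 0 t, P τ) + C * I * a n * (A / R + δ₀) * (2 * Real.sqrt t) :=
        fun y hy => norm_oseenDuhamel_two_region hC hK ht0 hRpos.le hR1 (ha0 n) hARδ hPi' hP0
          hnear1 hfarw hfaru hy
      have hB2 : ∀ y : EuclideanSpace ℝ (Fin 3), R + R / 2 ≤ ‖y‖ → ‖oseenDuhamel 1 0 V w t y‖ ≤
          C * volume.real (Metric.ball (0 : EuclideanSpace ℝ (Fin 3)) R) * (R / 2) ^ (-(4 : ℝ)) * (∫ τ in Ioo 0 t, P τ) + C * I * (A / R) * a n * (2 * Real.sqrt t) :=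
        fun y hy => norm_oseenDuhamel_two_region hC hK ht0 hRpos.le hR1 hAR (ha0 n) hPi' hP0
          hnear2 hfarV hfarw hy
      -- numerics: near total `≤ cnr δ'/R`, far total `≤ a n / 4`
      have hVR : volume.real (Metric.ball (0 : EuclideanSpace ℝ (Fin 3)) R) = R ^ 3 * V₁ := volume_real_ball_eq hRpos.le
      have hR4 : (R / 2) ^ (-(4 : ℝ)) = 16 / R ^ 4 := by
        rw [Real.rpow_neg (by positivity), show (4 : ℝ) = ((4 : ℕ) : ℝ) by norm_num, Real.rpow_natCast]
        field_simp
        ring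
      have hsqrt : Real.sqrt t ≤ 1 := by rw [show (1 : ℝ) = Real.sqrt 1 from Real.sqrt_one.symm]; exact Real.sqrt_le_sqrt ht1.le
      have hnear_tot : C * volume.real (Metric.ball (0 : EuclideanSpace ℝ (Fin 3)) R) * (R / 2) ^ (-(4 : ℝ)) * (∫ τ in Ioo 0 t, P τ) ≤ cnr * δ' / R / 2 := by
        rw [hVR, hR4]
        have h1 : C * (R ^ 3 * V₁) * (16 / R ^ 4) = 16 * C * V₁ / R := by field_simp
        rw [h1]
        calc 16 * C * V₁ / R * ∫ τ in Ioo 0 t, P τ ≤ 16 * C * V₁ / R * (δ' * (2 * M + 1)) :=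
              mul_le_mul_of_nonneg_left hPint
                (div_nonneg (mul_nonneg (mul_nonneg (by norm_num) hC.le) hV₁) hRpos.le)
          _ = cnr * δ' / R / 2 := by rw [hcnr_def]; field_simp; ring
      have hθ : 2 * (C * I) * (2 * (A / R) + δ₀) ≤ 1 / 4 := by
        have h1 : A / R ≤ A / r₀ := div_le_div_of_nonneg_left hA0 hr₀pos hRr₀
        have h2 : 4 * C₁ * (A / r₀) ≤ 1 / 8 := by
          rw [show 4 * C₁ * (A / r₀) = 4 * C₁ * A / r₀ by ring, div_le_iff₀ hr₀pos]
          nlinarith [hr₀A]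
        have h3 : 4 * C₁ * (A / R) ≤ 4 * C₁ * (A / r₀) := mul_le_mul_of_nonneg_left h1 (mul_nonneg (by norm_num) hC₁)
        show 2 * C₁ * (2 * (A / R) + δ₀) ≤ 1 / 4
        nlinarith [hδ₀C]
      have hfar_tot : C * I * a n * (A / R + δ₀) * (2 * Real.sqrt t) + C * I * (A / R) * a n * (2 * Real.sqrt t) ≤ 1 / 4 * a n := by
        have h1 : C * I * a n * (A / R + δ₀) * (2 * Real.sqrt t) + C * I * (A / R) * a n * (2 * Real.sqrt t) = (2 * (C * I) * (2 * (A / R) + δ₀)) * a n * Real.sqrt t := by ring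
        rw [h1]
        have h2 : 0 ≤ 2 * (C * I) * (2 * (A / R) + δ₀) := mul_nonneg (mul_nonneg (by norm_num) (mul_nonneg hC.le hI0)) (by linarith [hAR, hδ₀pos.le])
        calc 2 * (C * I) * (2 * (A / R) + δ₀) * a n * Real.sqrt t
            ≤ 2 * (C * I) * (2 * (A / R) + δ₀) * a n * 1 := mul_le_mul_of_nonneg_left hsqrt (mul_nonneg h2 (ha0 n))
          _ ≤ 1 / 4 * a n * 1 := by exact mul_le_mul_of_nonneg_right (mul_le_mul_of_nonneg_right hθ (ha0 n)) zero_le_one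
          _ = 1 / 4 * a n := mul_one _
      -- a.e. on the open set `{R + R/2 < ‖y‖}`
      have hUo : IsOpen {y : EuclideanSpace ℝ (Fin 3) | R + R / 2 < ‖y‖} := isOpen_lt continuous_const continuous_norm
      have hae : ∀ᵐ y ∂(volume : Measure (EuclideanSpace ℝ (Fin 3))), y ∈ {y : EuclideanSpace ℝ (Fin 3) | R + R / 2 < ‖y‖} → ‖w t y‖ ≤ a (n + 1) := by
        filter_upwards [hrepu t htI] with y hy hyU
        have hyU' : R + R / 2 ≤ ‖y‖ := le_of_lt hyU
        have hwy : w t y = (UnboundedOperators.heatExtension (u 0) (1 * t) y - UnboundedOperators.heatExtension (V 0) (1 * t) y) - (oseenDuhamel 1 0 u u t y - oseenDuhamel 1 0 V V t y) := by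
          show u t y - V t y = _
          rw [hy, hrepV t htI y]; abel
        rw [hwy, hBsplit t htI y]
        calc ‖UnboundedOperators.heatExtension (u 0) (1 * t) y - UnboundedOperators.heatExtension (V 0) (1 * t) y - (oseenDuhamel 1 0 w u t y + oseenDuhamel 1 0 V w t y)‖
            ≤ ‖UnboundedOperators.heatExtension (u 0) (1 * t) y - UnboundedOperators.heatExtension (V 0) (1 * t) y‖ + ‖oseenDuhamel 1 0 w u t y + oseenDuhamel 1 0 V w t y‖ := norm_sub_le _ _
          _ ≤ K₀ / ρ + (‖oseenDuhamel 1 0 w u t y‖ + ‖oseenDuhamel 1 0 V w t y‖) := add_le_add (hheat t htI y) (norm_add_le _ _)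
          _ ≤ K₀ / ρ + ((C * volume.real (Metric.ball (0 : EuclideanSpace ℝ (Fin 3)) R) * (R / 2) ^ (-(4 : ℝ)) * (∫ τ in Ioo 0 t, P τ) + C * I * a n * (A / R + δ₀) * (2 * Real.sqrt t)) +
              (C * volume.real (Metric.ball (0 : EuclideanSpace ℝ (Fin 3)) R) * (R / 2) ^ (-(4 : ℝ)) * (∫ τ in Ioo 0 t, P τ) + C * I * (A / R) * a n * (2 * Real.sqrt t))) :=
              add_le_add le_rfl (add_le_add (hB1 y hyU') (hB2 y hyU'))
          _ ≤ K₀ / ρ + cnr * δ' / R + 1 / 4 * a n := by linarith [hnear_tot, hfar_tot]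
          _ ≤ a (n + 1) := hstep
      have hev := forall_norm_le_of_ae_norm_le_on' (hwcont t ht) hUo hae
      exact hev x (show R + R / 2 < ‖x‖ by linarith)
  -- ### the profile
  intro t ht x
  show ‖w t x‖ ≤ K / ρ + K / (‖x‖ + 1)
  have hx0 : 0 ≤ ‖x‖ := norm_nonneg _
  have hKρ : 0 ≤ K / ρ := div_nonneg hKnn hρ0.le
  by_cases hxr : ‖x‖ < r₀
  · -- inside the core radius: the bootstrap size suffices
    have h1 : ‖w t x‖ ≤ 1 := (hwδ t ht x).trans hδ'1
    have h2 : 1 ≤ K / (‖x‖ + 1) := by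
      rw [le_div_iff₀ (by positivity)]
      have : r₀ + 1 ≤ K := by rw [hK_def]; nlinarith [hK₀, hcnr, hr₀pos]
      linarith
    linarith
  · have hxr' : r₀ ≤ ‖x‖ := not_lt.1 hxr
    have hxpos : 0 < ‖x‖ := by linarith
    have hX : 1 ≤ ‖x‖ / r₀ := by rwa [le_div_iff₀ hr₀pos, one_mul]
    obtain ⟨n, hn1, hn2⟩ := exists_nat_pow_near hX one_lt_two
    have hxn : r₀ * 2 ^ n ≤ ‖x‖ := by
      have := mul_le_mul_of_nonneg_left hn1 hr₀pos.le
      rwa [mul_div_cancel₀ _ hr₀pos.ne'] at this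
    have hq := hQ n t ht x hxn
    -- `(1/2)^n ≤ 2 r₀ / ‖x‖`
    have hhalf : (1 / 2 : ℝ) ^ n ≤ 2 * r₀ / ‖x‖ := by
      have h2n : (0 : ℝ) < 2 ^ n := by positivity
      rw [one_div_pow, div_le_div_iff₀ h2n hxpos]
      rw [div_lt_iff₀ hr₀pos, pow_succ] at hn2
      nlinarith
    have hβn : β * (1 / 2 : ℝ) ^ n ≤ (16 * cnr + 4 * r₀) / (‖x‖ + 1) := by
      calc β * (1 / 2 : ℝ) ^ n ≤ β * (2 * r₀ / ‖x‖) := mul_le_mul_of_nonneg_left hhalf hβ0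
        _ = (2 * β * r₀) / ‖x‖ := by ring
        _ ≤ (2 * β * r₀) * (2 / (‖x‖ + 1)) := by
            rw [div_eq_mul_inv (2 * β * r₀)]
            refine mul_le_mul_of_nonneg_left ?_ (mul_nonneg (mul_nonneg (by norm_num) hβ0) hr₀pos.le)
            rw [inv_eq_one_div, div_le_div_iff₀ hxpos (by positivity)]
            linarith
        _ = (4 * β * r₀) / (‖x‖ + 1) := by ring
        _ ≤ (16 * cnr + 4 * r₀) / (‖x‖ + 1) := by
            refine div_le_div_of_nonneg_right ?_ (by positivity)
            rw [hβ_def]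
            have : 4 * (4 * cnr * δ' / r₀ + δ') * r₀ = 16 * cnr * δ' + 4 * r₀ * δ' := by field_simp; ring
            rw [this]
            nlinarith [hcnr, hr₀pos, hδ'.le, hδ'1]
    have hαK : α ≤ K / ρ := by
      rw [hα_def, show 4 / 3 * (K₀ / ρ) = (4 / 3 * K₀) / ρ by ring]
      refine div_le_div_of_nonneg_right ?_ hρ0.le
      rw [hK_def]; nlinarith [hK₀, hcnr, hr₀pos]
    have hK2 : (16 * cnr + 4 * r₀) / (‖x‖ + 1) ≤ K / (‖x‖ + 1) := by
      refine div_le_div_of_nonneg_right ?_ (by positivity)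
      rw [hK_def]; nlinarith [hK₀]
    calc ‖w t x‖ ≤ α + β * (1 / 2 : ℝ) ^ n := hq
      _ ≤ K / ρ + K / (‖x‖ + 1) := by linarith

/-- **The stub P3b′ is a theorem.** -/
theorem stubSupShadowingProfile_holds : StubSupShadowingProfile := fun _M _A _v hv hdec => supShadowingProfile_of_isTypeIAncientMild hv hdec

/-- **P3b′ BY NAME** — `stub_supShadowingProfile : StubSupShadowingProfile`. -/
theorem stub_supShadowingProfile : StubSupShadowingProfile := stubSupShadowingProfile_holds

end Summit.NavierStokesRegularity.NavierStokesRegularity.Cruxes.TypeIQuantSubcubicExp.TruncationEdge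

end
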